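import Summits.Parity.BatemanHorn.Theorems.AlmostPrimeZerosSystemLSDRealSegmentLocalMult
import Summits.Parity.BatemanHorn.Theorems.AlmostPrimeZerosSystemLSDRealSegmentEulerFactorAux
import Literature.NumberTheory.Sieve.BatemanHornProofs
import HarnessLib

/-!
# Route `AlmostPrimeZeros`, crux `SystemLSDRealSegment` (stmt-Parity-11292), line
# `beta-thinned-root-kernel`: the local structure of the Type-I coefficient (`stub_typeILocal`)

For a Bateman–Horn system `f = (f₁,…,f_k)` and real `y ≥ 1` we prove `TypeILocal k f y` for
`b = bCoeff f y` (`b(m) = Σ_{∏ dᵢ = m} ∏ᵢ h_y(dᵢ)·δ_f(d)`), given the local counts `LocalCounts` at all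
large primes (supplied by `stub_congruenceFacts`):

1. `0 ≤ b`, 2. `b(1) = 1`, 3. `b(mn) = b(m)b(n)` for `(m,n) = 1`, 4. `b(p) = (y−1)Σᵢρᵢ(p)/p`,
5. `b(p^ν) = 0` for `ν > 2k` — all in `…SystemLSDRealSegmentLocalMult.lean`;
6. **`b(p^ν) ≤ C/p²` for `ν ≥ 2` at every prime `p > P₀`** (the `LocalCounts` threshold): a tuple
   `(p^{vᵢ})` with a slot `vᵢ ≥ 3` has weight `0`; with a slot `vᵢ = 2` its density is read modulo
   `lcm = p²` and is `≤ #{n < p² : p² ∣ fᵢ(n)}/p² ≤ deg fᵢ/p²` (Hensel count); with two slots `= p` its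
   density is `0` (no common roots); weights are `≤ (y²)^k` and there are `≤ (2k+1)^k` tuples, so
   `C = (2k+1)^k (y²)^k Σ deg fᵢ`;
7. **`Σ_{ν ≤ 2k} b(p^ν) = E_p(y) = localFactor f p y` at EVERY prime**: reindex the tuples `(p^{vᵢ})` by
   exponent vectors `v`, drop those with a slot `≥ 3`, read every density modulo `p²`
   (`δ_f(p^v) = #{n < p² : p^{vᵢ} ∣ fᵢ(n) ∀ i}/p²`, the congruence being `lcm`-periodic with `lcm ∣ p²`),
   and factor the sum over `v ∈ {0,1,2}^k` (`Finset.prod_univ_sum`):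
   `Σ_{e ≤ 2} [p^e ∣ m]·thinCoeff y e = Σ_{e ≤ localExp p m} thinCoeff y e = y^{localExp p m}`.

References: H. Halberstam, H.-E. Richert, *Sieve Methods* (1974) §5.3 and Lemma 5.4; the line card
`Cruxes/SystemLSDRealSegment/Lines/beta-thinned-root-kernel.md`.
-/

open Filter Finset Polynomial
open scoped BigOperators Topology

namespace Summit.Parity.BatemanHorn.Cruxes.SystemLSDRealSegment.BetaThinnedRootKernel

open Literature.NumberTheory.Sieve

noncomputable section

variable {k : ℕ}

/-! ### The prime-power bound at a large prime -/

/-- For a tuple of prime powers `d = (p^{vᵢ})` and `y ≥ 1`: `∏ᵢ h_y(dᵢ) = ∏ᵢ thinCoeff y vᵢ ≤ (y²)^k`.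
[folklore] -/
theorem prod_thinWeight_prime_pow_le {y : ℝ} (hy : 1 ≤ y) {p : ℕ} (hp : p.Prime) {d v : Fin k → ℕ}
    (hdv : ∀ i, d i = p ^ v i) : ∏ i, thinWeight y (d i) ≤ (y ^ 2) ^ k := by
  calc ∏ i, thinWeight y (d i) ≤ ∏ _i : Fin k, y ^ 2 :=
        Finset.prod_le_prod (fun i _ => thinWeight_nonneg hy _) fun i _ => by
          rw [hdv i, thinWeight_prime_pow y hp]
          exact thinCoeff_le_sq hy _
    _ = (y ^ 2) ^ k := by simp

/-- At a prime `p` with no common roots of two members and the Hensel count, a tuple `d = (p^{vᵢ})` with all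
`vᵢ ≤ 2` and `Σ vᵢ ≥ 2` has density `δ_f(d) ≤ (Σ deg fᵢ)/p²` (a slot `vᵢ = 2`: `lcm d = p²` and
`c_f(d) ≤ #{n < p² : p² ∣ fᵢ(n)} ≤ deg fᵢ`; else two slots `= p` and `c_f(d) = 0`). [folklore] -/
theorem tupleDens_prime_pow_le (f : Fin k → ℤ[X]) {p : ℕ} (hp : p.Prime)
    (h2 : ∀ i j, i ≠ j → ∀ n : ℤ, ¬ ((p : ℤ) ∣ (f i).eval n ∧ (p : ℤ) ∣ (f j).eval n))
    (h3 : ∀ i, #((range (p ^ 2)).filter fun n : ℕ => ((p : ℤ) ^ 2) ∣ (f i).eval (n : ℤ)) ≤ (f i).natDegree)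
    {d v : Fin k → ℕ} (hdv : ∀ i, d i = p ^ v i) (hv2 : ∀ i, v i ≤ 2) (hsum : 2 ≤ ∑ i, v i) :
    tupleDens f d ≤ ((∑ i, (f i).natDegree : ℕ) : ℝ) / (p : ℝ) ^ 2 := by
  classical
  have hp0 : (0 : ℝ) < (p : ℝ) ^ 2 := by have := hp.pos; positivity
  by_cases hex : ∃ i, v i = 2
  · obtain ⟨i, hi⟩ := hex
    have hL : tupleLcm d = p ^ 2 := by
      refine Nat.dvd_antisymm (Finset.lcm_dvd fun j _ => ?_) ?_
      · rw [hdv j]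
        exact pow_dvd_pow p (hv2 j)
      · have := Finset.dvd_lcm (s := Finset.univ) (f := d) (Finset.mem_univ i)
        rwa [hdv i, hi] at this
    have hcount : tupleCount f d ≤ ∑ j, (f j).natDegree := by
      refine le_trans ?_ ((h3 i).trans (Finset.single_le_sum (f := fun j => (f j).natDegree)
        (fun j _ => Nat.zero_le _) (Finset.mem_univ i)))
      rw [tupleCount, hL]
      refine Finset.card_le_card fun n hn => ?_
      rw [Finset.mem_filter] at hn ⊢
      refine ⟨hn.1, ?_⟩
      have := hn.2 i
      rwa [hdv i, hi, Nat.cast_pow] at this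
    rw [tupleDens, hL, Nat.cast_pow]
    exact div_le_div_of_nonneg_right (by exact_mod_cast hcount) hp0.le
  · push Not at hex
    have hv1 : ∀ i, v i ≤ 1 := fun i => by
      have := hv2 i
      have := hex i
      omega
    -- the set of slots `= p` has `Σ vᵢ ≥ 2` elements
    set T := Finset.univ.filter (fun i => v i = 1) with hT
    have hcard : T.card = ∑ i, v i := by
      rw [Finset.card_eq_sum_ones, Finset.sum_filter]
      refine Finset.sum_congr rfl fun i _ => ?_
      have := hv1 i
      interval_cases (v i) <;> simp
    obtain ⟨i, hi, i', hi', hii'⟩ := Finset.one_lt_card.mp (by omega : 1 < T.card)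
    have hvi : v i = 1 := (Finset.mem_filter.mp hi).2
    have hvi' : v i' = 1 := (Finset.mem_filter.mp hi').2
    have hcount : tupleCount f d = 0 := by
      rw [tupleCount, Finset.card_eq_zero, Finset.eq_empty_iff_forall_notMem]
      intro n hn
      rw [Finset.mem_filter] at hn
      refine h2 i i' hii' n ⟨?_, ?_⟩
      · have := hn.2 i
        rwa [hdv i, hvi, pow_one] at this
      · have := hn.2 i'
        rwa [hdv i', hvi', pow_one] at this
    rw [tupleDens, hcount, Nat.cast_zero, zero_div]
    positivity

/-- **Prime-power bound.** At a prime `p` with no common roots of two members and the Hensel count, for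
`y ≥ 1` and `ν ≥ 2`: `b(p^ν) ≤ (2k+1)^k (y²)^k (Σ deg fᵢ) / p²`. [folklore] -/
theorem bCoeff_prime_pow_le (f : Fin k → ℤ[X]) {y : ℝ} (hy : 1 ≤ y) {p : ℕ} (hp : p.Prime)
    (h2 : ∀ i j, i ≠ j → ∀ n : ℤ, ¬ ((p : ℤ) ∣ (f i).eval n ∧ (p : ℤ) ∣ (f j).eval n))
    (h3 : ∀ i, #((range (p ^ 2)).filter fun n : ℕ => ((p : ℤ) ^ 2) ∣ (f i).eval (n : ℤ)) ≤ (f i).natDegree)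
    {ν : ℕ} (hν : 2 ≤ ν) :
    bCoeff f y (p ^ ν) ≤
      (2 * k + 1) ^ k * (y ^ 2) ^ k * ((∑ i, (f i).natDegree : ℕ) : ℝ) / (p : ℝ) ^ 2 := by
  set D : ℝ := ((∑ i, (f i).natDegree : ℕ) : ℝ) with hD
  have hD0 : 0 ≤ D := Nat.cast_nonneg _
  have hy0 : 0 ≤ y := by linarith
  rcases lt_or_ge (2 * k) ν with hlt | hle
  · rw [bCoeff_prime_pow_eq_zero f y hp hlt]
    positivity
  have hterm : ∀ d ∈ prodTuples k (p ^ ν),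
      (∏ i, thinWeight y (d i)) * tupleDens f d ≤ (y ^ 2) ^ k * (D / (p : ℝ) ^ 2) := by
    intro d hd
    obtain ⟨v, hdv, -, hsum⟩ := exists_pow_eq_of_mem_prodTuples hp hd
    by_cases h3v : ∃ i, 3 ≤ v i
    · obtain ⟨i, hi⟩ := h3v
      rw [Finset.prod_eq_zero (Finset.mem_univ i)
        (by rw [hdv i, thinWeight_prime_pow y hp, thinCoeff_of_three_le y hi]), zero_mul]
      positivity
    push Not at h3v
    exact mul_le_mul (prod_thinWeight_prime_pow_le hy hp hdv)
      (tupleDens_prime_pow_le f hp h2 h3 hdv (fun i => Nat.lt_succ_iff.mp (h3v i)) (hsum ▸ hν))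
      (tupleDens_nonneg f d) (by positivity)
  have hcard : (#(prodTuples k (p ^ ν)) : ℝ) ≤ (2 * k + 1) ^ k := by
    have h := (card_prodTuples_prime_pow_le (k := k) hp ν).trans
      (Nat.pow_le_pow_left (by omega : ν + 1 ≤ 2 * k + 1) k)
    exact_mod_cast h
  calc bCoeff f y (p ^ ν) = ∑ d ∈ prodTuples k (p ^ ν), (∏ i, thinWeight y (d i)) * tupleDens f d := rfl
    _ ≤ ∑ _d ∈ prodTuples k (p ^ ν), (y ^ 2) ^ k * (D / (p : ℝ) ^ 2) := Finset.sum_le_sum hterm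
    _ = #(prodTuples k (p ^ ν)) * ((y ^ 2) ^ k * (D / (p : ℝ) ^ 2)) := by
        rw [Finset.sum_const, nsmul_eq_mul]
    _ ≤ (2 * k + 1) ^ k * ((y ^ 2) ^ k * (D / (p : ℝ) ^ 2)) := by gcongr
    _ = _ := by ring

/-! ### Complete residue systems modulo `p²` and the identity `Σ_ν b(p^ν) = E_p(y)` -/

/-- If `lcm(d) ∣ N ≠ 0` then `δ_f(d) = #{n < N : dᵢ ∣ fᵢ(n) ∀ i}/N` (the tuple congruence is
`lcm(d)`-periodic, `periodic_tupleDvd`). [folklore] -/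
theorem tupleDens_eq_card_div (f : Fin k → ℤ[X]) {d : Fin k → ℕ} {N : ℕ} (hN : N ≠ 0)
    (hd : tupleLcm d ∣ N) :
    tupleDens f d =
      (#((range N).filter fun n : ℕ => ∀ i, ((d i : ℕ) : ℤ) ∣ (f i).eval (n : ℤ)) : ℝ) / N := by
  obtain ⟨m, hm⟩ := hd
  have hm0 : m ≠ 0 := by
    rintro rfl
    rw [mul_zero] at hm
    exact hN hm
  rw [hm, mul_comm (tupleLcm d) m, card_filter_range_mul_of_periodic _ (periodic_tupleDvd f d) m]
  unfold tupleDens tupleCount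
  push_cast
  rw [mul_div_mul_left _ _ (by exact_mod_cast hm0 : (m : ℝ) ≠ 0)]

/-- The local expansion at one member: `Σ_{e < 3} [p^e ∣ m]·thinCoeff y e = y^{localExp p m}`
(`[p^e ∣ m] = [e ≤ localExp p m]` for `e ≤ 2`, and `Σ_{e ≤ j} thinCoeff y e = y^{min(j,2)}`). [folklore] -/
theorem sum_ite_thinCoeff_eq_pow_localExp (p : ℕ) (y : ℝ) (m : ℤ) :
    ∑ e ∈ range 3, (if ((p ^ e : ℕ) : ℤ) ∣ m then thinCoeff y e else 0) = y ^ localExp p m := by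
  unfold localExp
  by_cases h2 : (p : ℤ) ^ 2 ∣ m
  · have h1 : (p : ℤ) ∣ m := (dvd_pow_self (p : ℤ) two_ne_zero).trans h2
    simp [Finset.sum_range_succ, h1, h2]
  · by_cases h1 : (p : ℤ) ∣ m
    · simp [Finset.sum_range_succ, h1, h2]
    · simp [Finset.sum_range_succ, h1, h2]

/-- **`Σ_{ν ≤ 2k} b(p^ν) = p⁻² Σ_{n < p²} y^{Σᵢ localExp p (fᵢ(n))}`** at every prime `p`, for every family
and every real `y`: reindex the tuples `(p^{vᵢ})` by exponent vectors, drop those with a slot `vᵢ ≥ 3`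
(weight `0`), read each density modulo `p²` (`lcm ∣ p²`), and factor the sum over `v ∈ {0,1,2}^k`
(`Finset.prod_univ_sum`). [folklore] -/
theorem sum_bCoeff_prime_pow_eq (f : Fin k → ℤ[X]) (y : ℝ) {p : ℕ} (hp : p.Prime) :
    ∑ ν ∈ range (2 * k + 1), bCoeff f y (p ^ ν) =
      ((p : ℝ) ^ 2)⁻¹ * ∑ n ∈ range (p ^ 2), y ^ (∑ i, localExp p ((f i).eval (n : ℤ))) := by
  classical
  -- the weight of an exponent vector
  set g : (Fin k → ℕ) → ℝ := fun v => (∏ i, thinCoeff y (v i)) * tupleDens f (fun i => p ^ v i)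
    with hg
  -- (a) `b(p^ν)` as a sum over exponent vectors
  have ha : ∀ ν, bCoeff f y (p ^ ν) = ∑ v ∈ Finset.Nat.antidiagonalTuple k ν, g v := by
    intro ν
    refine (Finset.sum_nbij (fun v : Fin k → ℕ => fun i => p ^ v i) ?_ ?_ ?_ ?_).symm
    · intro v hv
      rw [Finset.Nat.mem_antidiagonalTuple] at hv
      rw [prodTuples_eq_finMulAntidiag, Nat.mem_finMulAntidiag]
      exact ⟨by rw [Finset.prod_pow_eq_pow_sum, hv], pow_ne_zero _ hp.ne_zero⟩
    · intro v _ w _ hvw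
      funext i
      exact Nat.pow_right_injective hp.two_le (congr_fun hvw i)
    · intro d hd
      obtain ⟨v, hdv, -, hsum⟩ := exists_pow_eq_of_mem_prodTuples hp (Finset.mem_coe.mp hd)
      exact ⟨v, Finset.mem_coe.mpr (Finset.Nat.mem_antidiagonalTuple.mpr hsum),
        funext fun i => (hdv i).symm⟩
    · intro v _
      simp only [hg, thinWeight_prime_pow y hp]
  -- (b) vectors with a slot `≥ 3` do not contribute; the rest is the fibre of `{0,1,2}^k` over `ν`
  have hb : ∀ ν, ∑ v ∈ Finset.Nat.antidiagonalTuple k ν, g v =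
      ∑ v ∈ (Fintype.piFinset fun _ : Fin k => range 3).filter (fun v => ∑ i, v i = ν), g v := by
    intro ν
    have hzero : ∀ v ∈ Finset.Nat.antidiagonalTuple k ν, g v ≠ 0 → ∀ i, v i < 3 := by
      intro v _ hne i
      by_contra hi
      push Not at hi
      apply hne
      simp only [hg]
      rw [Finset.prod_eq_zero (Finset.mem_univ i) (thinCoeff_of_three_le y hi), zero_mul]
    rw [← Finset.sum_filter_of_ne hzero]
    congr 1
    ext v
    simp only [Finset.mem_filter, Finset.Nat.mem_antidiagonalTuple, Fintype.mem_piFinset,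
      Finset.mem_range]
    exact and_comm
  -- (c) sum over the fibres
  have hc : ∑ ν ∈ range (2 * k + 1), bCoeff f y (p ^ ν) =
      ∑ v ∈ Fintype.piFinset (fun _ : Fin k => range 3), g v := by
    simp only [ha, hb]
    refine Finset.sum_fiberwise_of_maps_to (fun v hv => ?_) g
    have h2 : ∀ i, v i ≤ 2 := fun i =>
      Nat.lt_succ_iff.mp (Finset.mem_range.mp (Fintype.mem_piFinset.mp hv i))
    have : ∑ i, v i ≤ ∑ _i : Fin k, 2 := Finset.sum_le_sum fun i _ => h2 i
    rw [Finset.sum_const, Finset.card_univ, Fintype.card_fin, smul_eq_mul] at this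
    exact Finset.mem_range.mpr (by omega)
  -- (d) each density read modulo `p²`
  have hd : ∀ v ∈ Fintype.piFinset (fun _ : Fin k => range 3), g v =
      ((p : ℝ) ^ 2)⁻¹ * ∑ n ∈ range (p ^ 2),
        ∏ i, (if ((p ^ v i : ℕ) : ℤ) ∣ (f i).eval (n : ℤ) then thinCoeff y (v i) else 0) := by
    intro v hv
    have h2 : ∀ i, v i ≤ 2 := fun i =>
      Nat.lt_succ_iff.mp (Finset.mem_range.mp (Fintype.mem_piFinset.mp hv i))
    have hL : tupleLcm (fun i => p ^ v i) ∣ p ^ 2 := Finset.lcm_dvd fun i _ => pow_dvd_pow p (h2 i)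
    have key : ∀ n : ℕ, (∏ i, if ((p ^ v i : ℕ) : ℤ) ∣ (f i).eval (n : ℤ) then thinCoeff y (v i) else 0) =
        (∏ i, thinCoeff y (v i)) *
          (if (∀ i, ((p ^ v i : ℕ) : ℤ) ∣ (f i).eval (n : ℤ)) then 1 else 0) := by
      intro n
      rw [Fintype.prod_ite_zero, mul_boole]
      congr 1
    simp only [hg, key]
    rw [tupleDens_eq_card_div f (pow_ne_zero 2 hp.ne_zero) hL, Finset.natCast_card_filter,
      ← Finset.mul_sum, Nat.cast_pow]
    ring
  -- (e) factor the sum over `{0,1,2}^k`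
  calc ∑ ν ∈ range (2 * k + 1), bCoeff f y (p ^ ν)
      = ∑ v ∈ Fintype.piFinset (fun _ : Fin k => range 3), g v := hc
    _ = ∑ v ∈ Fintype.piFinset (fun _ : Fin k => range 3), ((p : ℝ) ^ 2)⁻¹ * ∑ n ∈ range (p ^ 2),
          ∏ i, (if ((p ^ v i : ℕ) : ℤ) ∣ (f i).eval (n : ℤ) then thinCoeff y (v i) else 0) :=
        Finset.sum_congr rfl hd
    _ = ((p : ℝ) ^ 2)⁻¹ * ∑ n ∈ range (p ^ 2), ∑ v ∈ Fintype.piFinset (fun _ : Fin k => range 3),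
          ∏ i, (if ((p ^ v i : ℕ) : ℤ) ∣ (f i).eval (n : ℤ) then thinCoeff y (v i) else 0) := by
        rw [← Finset.mul_sum, Finset.sum_comm]
    _ = ((p : ℝ) ^ 2)⁻¹ * ∑ n ∈ range (p ^ 2),
          ∏ i : Fin k, ∑ e ∈ range 3, (if ((p ^ e : ℕ) : ℤ) ∣ (f i).eval (n : ℤ) then thinCoeff y e else 0) := by
        congr 1
        refine Finset.sum_congr rfl fun n _ => ?_
        exact (Finset.prod_univ_sum (fun _ : Fin k => range 3)
          (fun i e => if ((p ^ e : ℕ) : ℤ) ∣ (f i).eval (n : ℤ) then thinCoeff y e else 0)).symm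
    _ = ((p : ℝ) ^ 2)⁻¹ * ∑ n ∈ range (p ^ 2), y ^ (∑ i, localExp p ((f i).eval (n : ℤ))) := by
        congr 1
        refine Finset.sum_congr rfl fun n _ => ?_
        rw [Finset.prod_congr rfl fun i _ => sum_ite_thinCoeff_eq_pow_localExp p y _,
          Finset.prod_pow_eq_pow_sum]

/-- **`E_p(y) = Σ_{ν ≤ 2k} b(p^ν)`** (cast to `ℂ`) at every prime `p`, for every family and every real `y`.
[folklore] -/
theorem localFactor_ofReal_eq_sum_bCoeff (f : Fin k → ℤ[X]) (y : ℝ) {p : ℕ} (hp : p.Prime) :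
    localFactor f p (y : ℂ) = ((∑ ν ∈ range (2 * k + 1), bCoeff f y (p ^ ν) : ℝ) : ℂ) := by
  rw [sum_bCoeff_prime_pow_eq f y hp, localFactor]
  push_cast
  rfl

/-! ### The registered stub -/

/-- **stub_typeILocal** (registered stub of the checked skeleton, line `beta-thinned-root-kernel`): given the
local counts `LocalCounts` of Bateman–Horn systems at all large primes, for every Bateman–Horn system `f` and
every real `y ≥ 1` the Type-I coefficient `b = bCoeff f y` has the structure `TypeILocal k f y`:
non-negative, `b(1) = 1`, multiplicative on coprime arguments (CRT), `b(p) = (y−1)Σᵢρᵢ(p)/p` at every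
prime, `b(p^ν) = 0` for `ν > 2k`, `b(p^ν) ≤ C/p²` for `ν ≥ 2` at every prime beyond the `LocalCounts`
threshold (`C = (2k+1)^k (y²)^k Σ deg fᵢ`), and `E_p(y) = Σ_{ν ≤ 2k} b(p^ν)` at every prime. [folklore] -/
theorem stub_typeILocal : (∀ (k : ℕ) (f : Fin k → ℤ[X]), LocalCounts k f) →
    ∀ (k : ℕ) (f : Fin k → ℤ[X]), IsBatemanHornSystem f → ∀ y : ℝ, 1 ≤ y → TypeILocal k f y := by
  intro hLC k f hf y hy
  obtain ⟨P₀, hP₀⟩ := hLC k f hf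
  refine ⟨bCoeff_nonneg f hy, bCoeff_one f y, fun m n h => bCoeff_mul_of_coprime f y h,
    fun p hp => bCoeff_prime f y hp, fun p hp ν hν => bCoeff_prime_pow_eq_zero f y hp hν,
    ⟨P₀, (2 * k + 1) ^ k * (y ^ 2) ^ k * ((∑ i, (f i).natDegree : ℕ) : ℝ), fun p hp hpP ν hν => ?_⟩,
    fun p hp => localFactor_ofReal_eq_sum_bCoeff f y hp⟩
  obtain ⟨-, h2, h3⟩ := hP₀ p hp hpP
  exact bCoeff_prime_pow_le f hy hp h2 h3 hν

end

end Summit.Parity.BatemanHorn.Cruxes.SystemLSDRealSegment.BetaThinnedRootKernel
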